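import Mathlib
import HarnessLib
import Summits.Ventures.LatticeQCDFlow.Exactness.NCMCGeneralSpaceMartingaleProduct

/-!
# The martingale central limit theorem for TRIANGULAR ARRAYS (McLeish), I: the characteristic
# function of a row sum `Σ_{t<k_n} ζ_{n,t}` of array increments orthogonal to their past with
# `|ζ_{n,t}| ≤ c_n → 0`, a sure bound on the quadratic variation and `Σ_{t<k_n} ζ_{n,t}² → v` IN
# PROBABILITY tends to `exp(−v u²/2)`; hence `Σ_t ζ_{n,t} ⇒ N(0, v)`

HONEST FRAMING: exact (Metropolis-corrected) sampling algorithms for lattice gauge theory;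
figures of merit are autocorrelation/cost numbers at stated couplings and volumes; no
continuum-physics claim.

Venture `LatticeQCDFlow` (cell pub-lqcd), topic `Scoring`; FANOUT row 4 (`s0-u1-b`, GEN-30).
NEW WORK of the cell (a Lean proof of a textbook theorem), not a published result of ours; no
definition is introduced; nothing is cited as a fact — the statement is the bounded-increment,
triangular-array case of McLeish's martingale central limit theorem (D. L. McLeish, Ann. Probab. 2
(1974) 620–628, Thm 2.3; Hall–Heyde 1980, Thm 3.2 / Cor. 3.1), NAMED ONLY.  Row 13's
`Exactness.GeneralNCMC.tendstoInDistribution_sum_div_sqrt_of_orthogonal` is the SEQUENCE case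
`(√n)⁻¹ Σ_{t<n} D_t` with `|D_t| ≤ C` and `(1/n) Σ D_t² → σ²` ALMOST SURELY.  The error bar of an
error bar — the sampling law of the batch-means estimator `σ̂²` of the asymptotic variance (hence of
`τ̂_int`, row 4's A-versus-B `τ_int` column) — is a ROW sum of an array whose increments are
bounded by `c_n = O(1/√a_n) → 0` but not by `C/√N`, and whose quadratic variation converges only
IN PROBABILITY.  This file is the analytic half of the array theorem (the stopping argument that
removes the sure bound on the quadratic variation is `Scoring/MartingaleArrayCLT.lean`):

(1) **`tendsto_integral_exp_mul_rowSum_of_ae`** — `ζ_{n,t}` measurable, `|ζ_{n,t}| ≤ c_n` with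
`c_n → 0`, orthogonality `∫ F(ζ_{n,0},…,ζ_{n,t−1}) ζ_{n,t} dP = 0` for bounded measurable `F`, a sure
bound `Σ_{t<k_n} ζ_{n,t}² ≤ K` (eventually in `n`) and `Σ_{t<k_n} ζ_{n,t}² → v` almost surely ⇒
`∫ exp(iu Σ_t ζ_{n,t}) dP → exp(−v u²/2)`.  McLeish's product `e^{iuS} = Π(1 + iuζ) · Π e^{iuζ}/(1 + iuζ)`
with row 13's product lemmas (`Exactness/NCMCGeneralSpaceMartingaleProduct.lean`) applied ROW BY
ROW with the constant multiplier `u`: the first factor has mean one and norm `≤ e^{u²K/2}`, the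
second has norm `≤ 1` and tends a.s. to `e^{−vu²/2}` (the cubic remainder is `≤ (2/3)|u|³ K c_n → 0`),
dominated convergence.
(2) **`tendsto_integral_exp_mul_rowSum`** — the same with `Σ_t ζ_{n,t}² → v` IN PROBABILITY: every
subsequence has an almost surely convergent sub-subsequence (`TendstoInMeasure.exists_seq_tendsto_ae`)
and all hypotheses are row-wise, so (1) applies along it; `Filter.tendsto_of_subseq_tendsto`.
(3) **`tendstoInDistribution_rowSum_of_bound`** — Lévy's continuity theorem
(`ProbabilityMeasure.tendsto_iff_tendsto_charFun`, `charFun_gaussianReal`): `Σ_t ζ_{n,t} ⇒ N(0, v)`.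

NOT CLAIMED: Lindeberg-type (unbounded) increments; conditional-variance normalisation; rates;
functional versions; the removal of the sure bound (that is `Scoring/MartingaleArrayCLT.lean`).
-/

noncomputable section

namespace Summit.Ventures.LatticeQCDFlow.Scoring

open MeasureTheory ProbabilityTheory Filter Finset Complex
open Summit.Ventures.LatticeQCDFlow.Exactness.GeneralNCMC
open scoped Topology Real

variable {Ω : Type*} [MeasurableSpace Ω]

/-! ### The analytic core along one array -/

section Core

variable {P : Measure Ω} [IsProbabilityMeasure P] {ζ : ℕ → ℕ → Ω → ℝ} {k : ℕ → ℕ}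

/-- **THE ANALYTIC CORE (McLeish, array form, a.s. quadratic variation).**  `|ζ_{n,t}| ≤ c_n → 0`,
orthogonality to the past, `Σ_{t<k_n} ζ_{n,t}² ≤ K` surely (eventually in `n`) and
`Σ_{t<k_n} ζ_{n,t}² → v` almost surely: for every real `u`,
`∫ exp(i u Σ_{t<k_n} ζ_{n,t}) dP → exp(−v u²/2)`. -/
theorem tendsto_integral_exp_mul_rowSum_of_ae (hζm : ∀ n t, Measurable (ζ n t)) {c : ℕ → ℝ}
    (hc : ∀ n t ω, |ζ n t ω| ≤ c n) (hc0 : Tendsto c atTop (𝓝 0))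
    (horth : ∀ (n t : ℕ) (F : (Fin t → ℝ) → ℝ) (K' : ℝ), Measurable F → (∀ w, |F w| ≤ K') →
      ∫ ω, F (fun i => ζ n i ω) * ζ n t ω ∂P = 0)
    {K : ℝ} (hK : ∀ᶠ n in atTop, ∀ ω, ∑ t ∈ range (k n), ζ n t ω ^ 2 ≤ K)
    {v : ℝ} (hQV : ∀ᵐ ω ∂P, Tendsto (fun n => ∑ t ∈ range (k n), ζ n t ω ^ 2) atTop (𝓝 v))
    (u : ℝ) :
    Tendsto (fun n : ℕ =>
        ∫ ω, Complex.exp ((u : ℂ) * ((∑ t ∈ range (k n), ζ n t ω : ℝ) : ℂ) * I) ∂P)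
      atTop (𝓝 (Complex.exp (-((v : ℂ) * u ^ 2 / 2)))) := by
  set c' : ℂ := Complex.exp (-((v : ℂ) * u ^ 2 / 2)) with hc'
  -- `e^{i u S_n} = Z_n · U_n`
  have hexp : ∀ (n : ℕ) (ω : Ω),
      Complex.exp ((u : ℂ) * ((∑ t ∈ range (k n), ζ n t ω : ℝ) : ℂ) * I)
      = (∏ t ∈ range (k n), ((1 : ℂ) + ((u * ζ n t ω : ℝ) : ℂ) * I)) *
        ∏ t ∈ range (k n), Complex.exp (((u * ζ n t ω : ℝ) : ℂ) * I)
          / (1 + ((u * ζ n t ω : ℝ) : ℂ) * I) := by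
    intro n ω
    rw [← Finset.prod_mul_distrib]
    have hfac : ∀ t ∈ range (k n), ((1 : ℂ) + ((u * ζ n t ω : ℝ) : ℂ) * I) *
        (Complex.exp (((u * ζ n t ω : ℝ) : ℂ) * I) / (1 + ((u * ζ n t ω : ℝ) : ℂ) * I))
        = Complex.exp (((u * ζ n t ω : ℝ) : ℂ) * I) := fun t _ =>
      mul_div_cancel₀ _ (fun h => by simpa using congrArg Complex.re h)
    rw [Finset.prod_congr rfl hfac, ← Complex.exp_sum]
    congr 1
    push_cast
    rw [Finset.mul_sum, Finset.sum_mul]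
  -- measurability of `U_n`
  have hUm : ∀ n, Measurable fun ω => ∏ t ∈ range (k n),
      Complex.exp (((u * ζ n t ω : ℝ) : ℂ) * I) / (1 + ((u * ζ n t ω : ℝ) : ℂ) * I) := by
    intro n
    refine Finset.measurable_prod _ fun t _ => ?_
    have h1 : Measurable fun ω => ((u * ζ n t ω : ℝ) : ℂ) * I :=
      (Complex.measurable_ofReal.comp ((hζm n t).const_mul u)).mul_const I
    exact (Complex.measurable_exp.comp h1).div (measurable_const.add h1)
  -- `‖Z_n‖ ≤ e^{u² K/2}` eventually
  have hZle : ∀ᶠ n in atTop, ∀ ω,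
      ‖∏ t ∈ range (k n), ((1 : ℂ) + ((u * ζ n t ω : ℝ) : ℂ) * I)‖ ≤ Real.exp (u ^ 2 * K / 2) := by
    filter_upwards [hK] with n hn ω
    refine (norm_prod_one_add_mul_I_le_exp (fun t => u * ζ n t ω) (k n)).trans ?_
    refine Real.exp_le_exp.2 (div_le_div_of_nonneg_right ?_ (by norm_num))
    calc ∑ t ∈ range (k n), (u * ζ n t ω) ^ 2 = u ^ 2 * ∑ t ∈ range (k n), ζ n t ω ^ 2 := by
          rw [Finset.mul_sum]; exact Finset.sum_congr rfl fun t _ => by ring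
      _ ≤ u ^ 2 * K := mul_le_mul_of_nonneg_left (hn ω) (sq_nonneg u)
  -- `U_n → c'` almost surely
  have hUlim : ∀ᵐ ω ∂P, Tendsto (fun n => ∏ t ∈ range (k n),
      Complex.exp (((u * ζ n t ω : ℝ) : ℂ) * I) / (1 + ((u * ζ n t ω : ℝ) : ℂ) * I))
      atTop (𝓝 c') := by
    filter_upwards [hQV] with ω hω
    have hprod : ∀ n : ℕ, ∏ t ∈ range (k n),
        Complex.exp (((u * ζ n t ω : ℝ) : ℂ) * I) / (1 + ((u * ζ n t ω : ℝ) : ℂ) * I)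
        = Complex.exp (-(((∑ t ∈ range (k n), (u * ζ n t ω) ^ 2 : ℝ) : ℂ) / 2)
          - ∑ t ∈ range (k n), (Complex.log (1 + ((u * ζ n t ω : ℝ) : ℂ) * I)
            - (((u * ζ n t ω : ℝ) : ℂ) * I + ((u * ζ n t ω : ℝ) : ℂ) ^ 2 / 2))) := fun n =>
      prod_exp_div_eq_exp (fun t => u * ζ n t ω) (k n)
    simp_rw [hprod]
    rw [hc']
    refine ((Complex.continuous_exp.tendsto _).comp ?_)
    have hmain : Tendsto (fun n : ℕ => -(((∑ t ∈ range (k n), (u * ζ n t ω) ^ 2 : ℝ) : ℂ) / 2))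
        atTop (𝓝 (-((v : ℂ) * u ^ 2 / 2))) := by
      have h1 : Tendsto (fun n : ℕ => u ^ 2 * ∑ t ∈ range (k n), ζ n t ω ^ 2) atTop
          (𝓝 (u ^ 2 * v)) := hω.const_mul _
      have h2 : ∀ n : ℕ, (∑ t ∈ range (k n), (u * ζ n t ω) ^ 2 : ℝ)
          = u ^ 2 * ∑ t ∈ range (k n), ζ n t ω ^ 2 := by
        intro n; rw [Finset.mul_sum]; exact Finset.sum_congr rfl fun t _ => by ring
      have h3 : Tendsto (fun n : ℕ => (∑ t ∈ range (k n), (u * ζ n t ω) ^ 2 : ℝ)) atTop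
          (𝓝 (u ^ 2 * v)) := by
        simp_rw [h2]; exact h1
      have h4 : Tendsto (fun n : ℕ => ((∑ t ∈ range (k n), (u * ζ n t ω) ^ 2 : ℝ) : ℂ)) atTop
          (𝓝 (((u ^ 2 * v : ℝ)) : ℂ)) := (Complex.continuous_ofReal.tendsto _).comp h3
      have h5 := (h4.div_const (2 : ℂ)).neg
      convert h5 using 2
      push_cast
      ring
    have hrem : Tendsto (fun n : ℕ => ∑ t ∈ range (k n),
        (Complex.log (1 + ((u * ζ n t ω : ℝ) : ℂ) * I)
          - (((u * ζ n t ω : ℝ) : ℂ) * I + ((u * ζ n t ω : ℝ) : ℂ) ^ 2 / 2))) atTop (𝓝 0) := by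
      -- `‖R_n‖ ≤ (2/3)|u|³ K c_n` once `|u| c_n ≤ 1/2`
      have hbound : Tendsto (fun n : ℕ => 2 / 3 * (|u| ^ 3 * K * c n)) atTop (𝓝 0) := by
        simpa using (hc0.const_mul (|u| ^ 3 * K)).const_mul (2 / 3 : ℝ)
      have hsmall : ∀ᶠ n : ℕ in atTop, |u| * c n ≤ 1 / 2 := by
        have h0 : Tendsto (fun n : ℕ => |u| * c n) atTop (𝓝 0) := by
          simpa using hc0.const_mul |u|
        exact h0.eventually (ge_mem_nhds (by norm_num : (0 : ℝ) < 1 / 2))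
      refine squeeze_zero_norm' ?_ hbound
      filter_upwards [hsmall, hK] with n hn hKn
      have hxt : ∀ t ∈ range (k n), |u * ζ n t ω| ≤ 1 / 2 := fun t _ => by
        rw [abs_mul]
        exact (mul_le_mul_of_nonneg_left (hc n t ω) (abs_nonneg u)).trans hn
      refine (norm_sum_rho_le (fun t => u * ζ n t ω) (k n) hxt).trans ?_
      refine mul_le_mul_of_nonneg_left ?_ (by norm_num)
      have hcn : 0 ≤ c n := (abs_nonneg _).trans (hc n 0 ω)
      calc ∑ t ∈ range (k n), |u * ζ n t ω| ^ 3
          ≤ ∑ t ∈ range (k n), |u| ^ 3 * c n * ζ n t ω ^ 2 := by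
            refine Finset.sum_le_sum fun t _ => ?_
            have hz : |ζ n t ω| ^ 3 ≤ c n * ζ n t ω ^ 2 := by
              have h3 : |ζ n t ω| ^ 3 = ζ n t ω ^ 2 * |ζ n t ω| := by
                rw [← sq_abs (ζ n t ω)]; ring
              rw [h3, mul_comm]
              exact mul_le_mul_of_nonneg_right (hc n t ω) (sq_nonneg _)
            calc |u * ζ n t ω| ^ 3 = |u| ^ 3 * |ζ n t ω| ^ 3 := by rw [abs_mul, mul_pow]
              _ ≤ |u| ^ 3 * (c n * ζ n t ω ^ 2) := mul_le_mul_of_nonneg_left hz (by positivity)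
              _ = |u| ^ 3 * c n * ζ n t ω ^ 2 := by ring
        _ = |u| ^ 3 * c n * ∑ t ∈ range (k n), ζ n t ω ^ 2 := by rw [Finset.mul_sum]
        _ ≤ |u| ^ 3 * c n * K := mul_le_mul_of_nonneg_left (hKn ω) (by positivity)
        _ = |u| ^ 3 * K * c n := by ring
    have := hmain.sub hrem
    simpa using this
  -- `Z_n` has mean one, so `∫ e^{iuS_n} − c' = ∫ Z_n (U_n − c')`
  have hdiff : ∀ n : ℕ,
      ∫ ω, Complex.exp ((u : ℂ) * ((∑ t ∈ range (k n), ζ n t ω : ℝ) : ℂ) * I) ∂P - c'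
      = ∫ ω, (∏ t ∈ range (k n), ((1 : ℂ) + ((u * ζ n t ω : ℝ) : ℂ) * I)) *
        (∏ t ∈ range (k n), Complex.exp (((u * ζ n t ω : ℝ) : ℂ) * I)
            / (1 + ((u * ζ n t ω : ℝ) : ℂ) * I) - c') ∂P := by
    intro n
    have hZm := measurable_prod_one_add_mul_I (hζm n) u (k n)
    have hZint : Integrable (fun ω => ∏ t ∈ range (k n),
        ((1 : ℂ) + ((u * ζ n t ω : ℝ) : ℂ) * I)) P :=
      Integrable.of_bound hZm.aestronglyMeasurable ((1 + |u| * |c n|) ^ (k n))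
        (ae_of_all _ (norm_prod_one_add_mul_I_le_pow u (hc n) (k n)))
    have hZUint : Integrable (fun ω => (∏ t ∈ range (k n),
        ((1 : ℂ) + ((u * ζ n t ω : ℝ) : ℂ) * I)) *
        ∏ t ∈ range (k n), Complex.exp (((u * ζ n t ω : ℝ) : ℂ) * I)
          / (1 + ((u * ζ n t ω : ℝ) : ℂ) * I)) P := by
      refine Integrable.of_bound (hZm.mul (hUm n)).aestronglyMeasurable ((1 + |u| * |c n|) ^ (k n))
        (ae_of_all _ fun ω => ?_)
      rw [norm_mul]
      calc _ ≤ (1 + |u| * |c n|) ^ (k n) * 1 :=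
            mul_le_mul (norm_prod_one_add_mul_I_le_pow u (hc n) (k n) ω)
              (norm_prod_exp_div_le_one _ (k n)) (norm_nonneg _) (pow_nonneg (by positivity) _)
        _ = _ := mul_one _
    simp_rw [mul_sub, hexp]
    rw [integral_sub hZUint (hZint.mul_const c'), integral_mul_const,
      integral_prod_one_add_mul_I_eq_one (hζm n) (hc n) (horth n) u (k n), one_mul]
  -- dominated convergence: `∫ ‖U_n − c'‖ → 0`
  have hL1 : Tendsto (fun n => ∫ ω, ‖(∏ t ∈ range (k n),
      Complex.exp (((u * ζ n t ω : ℝ) : ℂ) * I) / (1 + ((u * ζ n t ω : ℝ) : ℂ) * I)) - c'‖ ∂P)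
      atTop (𝓝 0) := by
    have h := tendsto_integral_of_dominated_convergence (μ := P)
      (F := fun n ω => ‖(∏ t ∈ range (k n), Complex.exp (((u * ζ n t ω : ℝ) : ℂ) * I)
        / (1 + ((u * ζ n t ω : ℝ) : ℂ) * I)) - c'‖) (f := fun _ => (0 : ℝ)) (fun _ => 1 + ‖c'‖)
      (fun n => ((hUm n).sub_const c').norm.aestronglyMeasurable) (integrable_const _)
      (fun n => ae_of_all _ fun ω => ?_) ?_
    · simpa using h
    · rw [Real.norm_eq_abs, abs_norm]
      exact (norm_sub_le _ _).trans (add_le_add (norm_prod_exp_div_le_one _ (k n)) le_rfl)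
    · filter_upwards [hUlim] with ω hω
      have := (tendsto_sub_nhds_zero_iff.2 hω).norm
      simpa using this
  -- conclusion
  rw [← tendsto_sub_nhds_zero_iff]
  have hg := hL1.const_mul (Real.exp (u ^ 2 * K / 2))
  rw [mul_zero] at hg
  refine squeeze_zero_norm' ?_ hg
  filter_upwards [hZle] with n hn
  rw [hdiff n]
  refine (norm_integral_le_integral_norm _).trans ?_
  rw [← integral_const_mul]
  have hUcint : Integrable (fun ω => ‖(∏ t ∈ range (k n),
      Complex.exp (((u * ζ n t ω : ℝ) : ℂ) * I) / (1 + ((u * ζ n t ω : ℝ) : ℂ) * I)) - c'‖) P := by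
    refine Integrable.of_bound ((hUm n).sub_const c').norm.aestronglyMeasurable (1 + ‖c'‖)
      (ae_of_all _ fun ω => ?_)
    rw [Real.norm_eq_abs, abs_norm]
    exact (norm_sub_le _ _).trans (add_le_add (norm_prod_exp_div_le_one _ (k n)) le_rfl)
  refine integral_mono_of_nonneg (ae_of_all _ fun ω => norm_nonneg _) (hUcint.const_mul _)
    (ae_of_all _ fun ω => ?_)
  dsimp only
  rw [norm_mul]
  exact mul_le_mul_of_nonneg_right (hn ω) (norm_nonneg _)

/-- **THE ANALYTIC CORE WITH THE QUADRATIC VARIATION CONVERGING IN PROBABILITY.**  As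
`tendsto_integral_exp_mul_rowSum_of_ae`, but `Σ_{t<k_n} ζ_{n,t}² → v` only in measure: every
subsequence has an almost surely convergent sub-subsequence, along which the a.s. core applies. -/
theorem tendsto_integral_exp_mul_rowSum (hζm : ∀ n t, Measurable (ζ n t)) {c : ℕ → ℝ}
    (hc : ∀ n t ω, |ζ n t ω| ≤ c n) (hc0 : Tendsto c atTop (𝓝 0))
    (horth : ∀ (n t : ℕ) (F : (Fin t → ℝ) → ℝ) (K' : ℝ), Measurable F → (∀ w, |F w| ≤ K') →
      ∫ ω, F (fun i => ζ n i ω) * ζ n t ω ∂P = 0)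
    {K : ℝ} (hK : ∀ᶠ n in atTop, ∀ ω, ∑ t ∈ range (k n), ζ n t ω ^ 2 ≤ K)
    {v : ℝ} (hQV : TendstoInMeasure P (fun n ω => ∑ t ∈ range (k n), ζ n t ω ^ 2) atTop
      (fun _ => v))
    (u : ℝ) :
    Tendsto (fun n : ℕ =>
        ∫ ω, Complex.exp ((u : ℂ) * ((∑ t ∈ range (k n), ζ n t ω : ℝ) : ℂ) * I) ∂P)
      atTop (𝓝 (Complex.exp (-((v : ℂ) * u ^ 2 / 2)))) := by
  refine tendsto_of_subseq_tendsto fun ns hns => ?_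
  have h1 : TendstoInMeasure P (fun j ω => ∑ t ∈ range (k (ns j)), ζ (ns j) t ω ^ 2) atTop
      (fun _ => v) := fun ε hε => (hQV ε hε).comp hns
  obtain ⟨ms, hms, hae⟩ := h1.exists_seq_tendsto_ae
  refine ⟨ms, ?_⟩
  have hφ : Tendsto (fun j => ns (ms j)) atTop atTop := hns.comp hms.tendsto_atTop
  exact tendsto_integral_exp_mul_rowSum_of_ae (ζ := fun j => ζ (ns (ms j)))
    (k := fun j => k (ns (ms j))) (fun j t => hζm _ t) (c := fun j => c (ns (ms j)))
    (fun j t ω => hc _ t ω) (hc0.comp hφ) (fun j t F K' hF hFb => horth _ t F K' hF hFb)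
    (hφ.eventually hK) hae u

/-- **ROW SUMS OF AN ORTHOGONAL ARRAY ARE ASYMPTOTICALLY GAUSSIAN (sure quadratic-variation
bound).**  Under the hypotheses of `tendsto_integral_exp_mul_rowSum` and `0 ≤ v`, for every `Y`
with law `N(0, v)`: `TendstoInDistribution (fun n ω => Σ_{t<k_n} ζ_{n,t} ω) atTop Y (fun _ => P) P'`. -/
theorem tendstoInDistribution_rowSum_of_bound (hζm : ∀ n t, Measurable (ζ n t)) {c : ℕ → ℝ}
    (hc : ∀ n t ω, |ζ n t ω| ≤ c n) (hc0 : Tendsto c atTop (𝓝 0))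
    (horth : ∀ (n t : ℕ) (F : (Fin t → ℝ) → ℝ) (K' : ℝ), Measurable F → (∀ w, |F w| ≤ K') →
      ∫ ω, F (fun i => ζ n i ω) * ζ n t ω ∂P = 0)
    {K : ℝ} (hK : ∀ᶠ n in atTop, ∀ ω, ∑ t ∈ range (k n), ζ n t ω ^ 2 ≤ K)
    {v : ℝ} (hv : 0 ≤ v) (hQV : TendstoInMeasure P (fun n ω => ∑ t ∈ range (k n), ζ n t ω ^ 2)
      atTop (fun _ => v))
    {Ω' : Type*} [MeasurableSpace Ω'] {P' : Measure Ω'} [IsProbabilityMeasure P'] {Y : Ω' → ℝ}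
    (hY : HasLaw Y (gaussianReal 0 v.toNNReal) P') :
    TendstoInDistribution (fun (n : ℕ) ω => ∑ t ∈ range (k n), ζ n t ω) atTop Y
      (fun _ => P) P' := by
  have hXm : ∀ n : ℕ, Measurable fun ω => ∑ t ∈ range (k n), ζ n t ω := fun n =>
    Finset.measurable_sum _ fun t _ => hζm n t
  refine ⟨fun n => (hXm n).aemeasurable, hY.aemeasurable, ?_⟩
  refine ProbabilityMeasure.tendsto_iff_tendsto_charFun.2 fun w => ?_
  have hL : ∀ n : ℕ, charFun (P.map fun ω => ∑ t ∈ range (k n), ζ n t ω) w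
      = ∫ ω, Complex.exp ((w : ℂ) * ((∑ t ∈ range (k n), ζ n t ω : ℝ) : ℂ) * I) ∂P := by
    intro n
    rw [charFun_apply_real, integral_map (hXm n).aemeasurable (by fun_prop)]
  have hR : charFun (P'.map Y) w = Complex.exp (-((v : ℂ) * w ^ 2 / 2)) := by
    rw [hY.map_eq, charFun_gaussianReal, Real.coe_toNNReal _ hv]
    congr 1
    push_cast
    ring
  simp only [ProbabilityMeasure.coe_mk, hL, hR]
  exact tendsto_integral_exp_mul_rowSum hζm hc hc0 horth hK hQV w

end Core

end Summit.Ventures.LatticeQCDFlow.Scoring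

end
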